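import Mathlib
import Literature.Analysis.FluidPDE.VectorCalculus
import Summits.NavierStokesRegularity.NavierStokesRegularity.Theorems.ThreadingFluxErtelTowerInviscidStrainRigidity
import HarnessLib

/-!
# Crux `PoloidalLiouville` (stmt-NavierStokesRegularity-1222, W1), crux idea «radial-jerk-tower» (ns-idea-15 g7):
# THE GENERAL ERTEL STEP FOR A FROZEN FIELD, the smooth RADIAL-JERK TOWER, and INVISCID KINEMATIC RIGIDITY

Support file (`--supports stmt-NavierStokesRegularity-1222`, helper).  Experiment cell `ns-wall-extremal`, width hand
ns-wall-eng-5 g6, director KEY-NS #186 (critic V21 sizes: `InviscidKinematicRigidity` M, «first formal step = joint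
`ContDiffOn` of `radialJerk` by induction»).  0 kit.

For a drift `u`, a field `B` and a scalar `θ`, all jointly smooth on an open `I × U ⊆ ℝ × ℝ³`:
* `hasDerivAt_slice_time`, `hasFDerivAt_slice_space`, `inner_gradient_slice_space`, `materialDeriv_eq`, `succ_eq_fderiv` —
  the successor of the radial-jerk tower `θ⁺ = ∂ₜθ + ⟪u, ∇θ⟫` IS the material derivative `D(uncurry θ)[(1,u)]`;
  `contDiffOn_succ` — it is jointly smooth on `I × U`;
* ★ `ErtelTower.ertel_step_frozen` — **the general Ertel step**: if `B` is FROZEN into `u` (`∂ₜB + DB[u] − Du[B] = 0`) and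
  `⟪B, ∇θ⟫ ≡ 0` on `I × U`, then `⟪B, ∇θ⁺⟫ ≡ 0` there.  Proof without flow maps: `p ↦ D(uncurry θ)(p)[(0, B p)] = ⟪B,∇θ⟫`
  vanishes on the open set, so its derivative along `(1, u)` vanishes; expand by the Leibniz rule (`HasFDerivAt.clm_apply`),
  insert the frozen equation, and compare with `D_xθ⁺[B]` — the difference is exactly the symmetry of the second derivative
  of `uncurry θ` (`ContDiffAt.isSymmSndFDerivAt`);
* `contDiffOn_radialJerk` — every level `radialJerk u x₀ k` is jointly smooth on `I × U` (induction via `contDiffOn_succ`);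
  `inner_gradient_radialJerk_eq_zero` — for a frozen sphere-tangent `B`, EVERY radial jerk is a vortex-line integral:
  `⟪B, ∇θ_k⟫ ≡ 0` for all `k` (level 0 = tangency via `gradient_radial`, step = `ertel_step_frozen`);
* `eq_zero_of_inner_frame` — Cramer: `w ⊥ p, q, r` and `⟪p, q × r⟫ ≠ 0` ⇒ `w = 0`;
* ★★ `ErtelTower.inviscidKinematicRigidity : InviscidKinematicRigidity` — **the sketch Prop (`ErtelTowerSketch.lean` l.437,
  twin in `ThreadingFluxErtelTowerDefs`) is a theorem**: a field frozen into ANY smooth drift and tangent to the spheres about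
  `x₀` on `I × U` vanishes identically as soon as, at each time, the points where `x − x₀, ∇θ₁, ∇θ₂` span are dense in `U`.
  Neither incompressibility of `u` nor `div B = 0` is used.

HONEST FRAME (critic V21-P4 words): a statement about the FROZEN-FIELD (inviscid, linear) equation in a prescribed drift — the
kinematics of the linearisation — not about ⟨27585⟩ `UnthreadedRigidity` or ⟨1222⟩ `PoloidalLiouville`, which are OPEN;
NS regularity is NOT proved.

## References
* H. Ertel, Ein neuer hydrodynamischer Wirbelsatz, Meteorol. Z. 59 (1942) 277–281. [Ertel1942]
* A. J. Majda, A. L. Bertozzi, *Vorticity and Incompressible Flow* (CUP 2002), §1.6 Prop. 1.8 / Lemma 1.4 (frozen fields). [MajdaBertozziCUP2002]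
-/

-- the summit and its single problem share the name (D-0017 nested layout)
set_option linter.dupNamespace false

noncomputable section

namespace Summit.NavierStokesRegularity.NavierStokesRegularity.Theorems.PoloidalLiouville.ErtelTower

open Set Function Filter Topology Metric
open scoped Topology RealInnerProductSpace InnerProductSpace
open Literature.Analysis.FluidPDE
open Summit.NavierStokesRegularity.NavierStokesRegularity.Theorems.PoloidalLiouville.HorizonTower (E3)

/-! ### Slices and the material derivative of a jointly smooth scalar -/

section Slices

variable {F : ℝ × E3 → ℝ} {t : ℝ} {z : E3}

/-- The time slice `s ↦ F(s,z)` has derivative `DF(t,z)[(1,0)]`. -/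
theorem hasDerivAt_slice_time (hF : DifferentiableAt ℝ F (t, z)) :
    HasDerivAt (fun s : ℝ => F (s, z)) (fderiv ℝ F (t, z) (1, 0)) t := by
  have h1 : HasDerivAt (fun s : ℝ => (s, z)) (1, 0) t := (hasDerivAt_id t).prodMk (hasDerivAt_const t z)
  exact hF.hasFDerivAt.comp_hasDerivAt t h1

/-- The space slice `w ↦ F(t,w)` has derivative `DF(t,z) ∘ (0, ·)`. -/
theorem hasFDerivAt_slice_space (hF : DifferentiableAt ℝ F (t, z)) :
    HasFDerivAt (fun w : E3 => F (t, w)) ((fderiv ℝ F (t, z)).comp (ContinuousLinearMap.inr ℝ ℝ E3)) z := by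
  have h1 : HasFDerivAt (fun w : E3 => (t, w)) (ContinuousLinearMap.inr ℝ ℝ E3) z :=
    (hasFDerivAt_const t z).prodMk (hasFDerivAt_id z)
  exact hF.hasFDerivAt.comp z h1

/-- `⟪∇_z F(t,·)(z), v⟫ = DF(t,z)[(0,v)]`. -/
theorem inner_gradient_slice_space (hF : DifferentiableAt ℝ F (t, z)) (v : E3) :
    inner ℝ (gradient (fun w : E3 => F (t, w)) z) v = fderiv ℝ F (t, z) (0, v) := by
  rw [_root_.inner_gradient_left, (hasFDerivAt_slice_space hF).fderiv]
  rfl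

/-- The MATERIAL DERIVATIVE along a drift value `a`: `∂ₜF + ⟪a, ∇F⟫ = DF(t,z)[(1,a)]`. -/
theorem materialDeriv_eq (hF : DifferentiableAt ℝ F (t, z)) (a : E3) :
    deriv (fun s : ℝ => F (s, z)) t + inner ℝ a (gradient (fun w : E3 => F (t, w)) z) = fderiv ℝ F (t, z) (1, a) := by
  rw [(hasDerivAt_slice_time hF).deriv, real_inner_comm, inner_gradient_slice_space hF]
  have h : ((1 : ℝ), a) = ((1 : ℝ), (0 : E3)) + ((0 : ℝ), a) := by simp
  rw [h, map_add]

end Slices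

/-! ### The general Ertel step for a frozen field -/

section Step

variable {u B : ℝ → E3 → E3} {θ : ℝ → E3 → ℝ} {I : Set ℝ} {U : Set E3}

/-- Joint smoothness at interior points. -/
theorem contDiffAt_of_contDiffOn_prod {G : Type*} [NormedAddCommGroup G] [NormedSpace ℝ G] {f : ℝ × E3 → G}
    {n : WithTop ℕ∞} (hf : ContDiffOn ℝ n f (I ×ˢ U)) (hI : IsOpen I) (hU : IsOpen U) {t : ℝ} {x : E3}
    (ht : t ∈ I) (hx : x ∈ U) : ContDiffAt ℝ n f (t, x) :=
  hf.contDiffAt ((hI.prod hU).mem_nhds ⟨ht, hx⟩)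

/-- **The successor in the radial-jerk tower is the material derivative**: on `I × U`,
`∂ₜθ + ⟪u, ∇θ⟫ = D(uncurry θ)(t,x)[(1, u(t,x))]`. -/
theorem succ_eq_fderiv (hθ : ContDiffOn ℝ (⊤ : ℕ∞) (Function.uncurry θ) (I ×ˢ U)) (hI : IsOpen I) (hU : IsOpen U)
    {t : ℝ} {x : E3} (ht : t ∈ I) (hx : x ∈ U) :
    deriv (fun s => θ s x) t + inner ℝ (u t x) (gradient (θ t) x)
      = fderiv ℝ (Function.uncurry θ) (t, x) (1, u t x) := by
  have hd : DifferentiableAt ℝ (Function.uncurry θ) (t, x) :=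
    (contDiffAt_of_contDiffOn_prod hθ hI hU ht hx).differentiableAt (by simp)
  exact materialDeriv_eq (F := Function.uncurry θ) hd (u t x)

/-- **The successor of a jointly smooth tower function is jointly smooth on `I × U`.** -/
theorem contDiffOn_succ (hu : ContDiffOn ℝ (⊤ : ℕ∞) (Function.uncurry u) (I ×ˢ U))
    (hθ : ContDiffOn ℝ (⊤ : ℕ∞) (Function.uncurry θ) (I ×ˢ U)) (hI : IsOpen I) (hU : IsOpen U) :
    ContDiffOn ℝ (⊤ : ℕ∞)
      (Function.uncurry fun t x => deriv (fun s => θ s x) t + inner ℝ (u t x) (gradient (θ t) x)) (I ×ˢ U) := by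
  have hopen : IsOpen (I ×ˢ U) := hI.prod hU
  -- the smooth right-hand side `p ↦ D(uncurry θ)(p)[(1, u p)]`
  have hD : ContDiffOn ℝ (⊤ : ℕ∞) (fderiv ℝ (Function.uncurry θ)) (I ×ˢ U) :=
    (hθ.fderiv_of_isOpen hopen le_rfl)
  have hv : ContDiffOn ℝ (⊤ : ℕ∞) (fun p : ℝ × E3 => ((1 : ℝ), Function.uncurry u p)) (I ×ˢ U) :=
    contDiffOn_const.prodMk hu
  have hrhs : ContDiffOn ℝ (⊤ : ℕ∞)
      (fun p : ℝ × E3 => fderiv ℝ (Function.uncurry θ) p ((1 : ℝ), Function.uncurry u p)) (I ×ˢ U) :=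
    hD.clm_apply hv
  refine hrhs.congr fun p hp => ?_
  obtain ⟨t, x⟩ := p
  exact succ_eq_fderiv hθ hI hU hp.1 hp.2

/-- **GENERAL ERTEL STEP (frozen field).**  Let `u, B, θ` be jointly smooth on the open set `I × U`, `B` frozen into `u`
(`∂ₜB + DB[u] − Du[B] = 0`) and `⟪B, ∇θ⟫ ≡ 0` there.  Then `⟪B, ∇θ⁺⟫ ≡ 0` for the successor
`θ⁺ = ∂ₜθ + ⟪u, ∇θ⟫`.  Proof: `G(p) := D(uncurry θ)(p)[(0, B p)] = ⟪B, ∇θ⟫ ≡ 0` on the open set, so `DG(t,x)[(1,u)] = 0`;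
expanding with the Leibniz rule and the frozen equation, and comparing with `D_x θ⁺[B]` (θ⁺ = the material derivative
`D(uncurry θ)[(1,u)]`), the two differ exactly by the SYMMETRY of the second derivative of `uncurry θ`. -/
theorem ertel_step_frozen (hI : IsOpen I) (hU : IsOpen U)
    (hu : ContDiffOn ℝ (⊤ : ℕ∞) (Function.uncurry u) (I ×ˢ U))
    (hB : ContDiffOn ℝ (⊤ : ℕ∞) (Function.uncurry B) (I ×ˢ U))
    (hθ : ContDiffOn ℝ (⊤ : ℕ∞) (Function.uncurry θ) (I ×ˢ U))
    (hfrozen : ∀ t ∈ I, ∀ x ∈ U,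
      deriv (fun s => B s x) t + fderiv ℝ (B t) x (u t x) - fderiv ℝ (u t) x (B t x) = 0)
    (hlevel : ∀ t ∈ I, ∀ x ∈ U, inner ℝ (B t x) (gradient (θ t) x) = 0) :
    ∀ t ∈ I, ∀ x ∈ U,
      inner ℝ (B t x) (gradient (fun z => deriv (fun s => θ s z) t + inner ℝ (u t z) (gradient (θ t) z)) x) = 0 := by
  intro t ht x hx
  set F := Function.uncurry θ with hFdef
  have hopen : IsOpen (I ×ˢ U) := hI.prod hU
  have hmem : (t, x) ∈ I ×ˢ U := ⟨ht, hx⟩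
  -- smoothness at (t,x)
  have hFat : ContDiffAt ℝ (⊤ : ℕ∞) F (t, x) := contDiffAt_of_contDiffOn_prod hθ hI hU ht hx
  have hBat : ContDiffAt ℝ (⊤ : ℕ∞) (Function.uncurry B) (t, x) := contDiffAt_of_contDiffOn_prod hB hI hU ht hx
  have huat : ContDiffAt ℝ (⊤ : ℕ∞) (Function.uncurry u) (t, x) := contDiffAt_of_contDiffOn_prod hu hI hU ht hx
  have hDF : ContDiffAt ℝ (⊤ : ℕ∞) (fderiv ℝ F) (t, x) :=
    hFat.fderiv_right (m := (⊤ : ℕ∞)) (by exact_mod_cast le_top)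
  have hDFd : DifferentiableAt ℝ (fderiv ℝ F) (t, x) := hDF.differentiableAt (by simp)
  have hBd : DifferentiableAt ℝ (Function.uncurry B) (t, x) := hBat.differentiableAt (by simp)
  have hud : DifferentiableAt ℝ (Function.uncurry u) (t, x) := huat.differentiableAt (by simp)
  -- (1) `G(p) = DF(p)[(0, B p)]` vanishes on `I × U`, hence `DG(t,x) = 0`
  have hG0 : ∀ p ∈ I ×ˢ U, fderiv ℝ F p ((0 : ℝ), Function.uncurry B p) = 0 := by
    rintro ⟨s, z⟩ hp
    have hd : DifferentiableAt ℝ F (s, z) :=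
      (contDiffAt_of_contDiffOn_prod hθ hI hU hp.1 hp.2).differentiableAt (by simp)
    rw [← inner_gradient_slice_space hd, real_inner_comm]
    exact hlevel s hp.1 z hp.2
  have hGev : (fun p : ℝ × E3 => fderiv ℝ F p ((0 : ℝ), Function.uncurry B p)) =ᶠ[𝓝 (t, x)] fun _ => (0 : ℝ) := by
    filter_upwards [hopen.mem_nhds hmem] with p hp using hG0 p hp
  -- Leibniz rule for `G`
  have hw : HasFDerivAt (fun p : ℝ × E3 => ((0 : ℝ), Function.uncurry B p))
      ((0 : ℝ × E3 →L[ℝ] ℝ).prod (fderiv ℝ (Function.uncurry B) (t, x))) (t, x) :=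
    (hasFDerivAt_const (0 : ℝ) (t, x)).prodMk hBd.hasFDerivAt
  have hG := hDFd.hasFDerivAt.clm_apply hw
  have hDG : fderiv ℝ (fun p : ℝ × E3 => fderiv ℝ F p ((0 : ℝ), Function.uncurry B p)) (t, x) = 0 := by
    rw [hGev.fderiv_eq]; simp
  have key1 : (fderiv ℝ F (t, x)) (((0 : ℝ × E3 →L[ℝ] ℝ).prod (fderiv ℝ (Function.uncurry B) (t, x))) (1, u t x))
      + (fderiv ℝ (fderiv ℝ F) (t, x) (1, u t x)) ((0 : ℝ), B t x) = 0 := by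
    have h := congrArg (fun L : ℝ × E3 →L[ℝ] ℝ => L ((1 : ℝ), u t x)) (hG.fderiv.symm.trans hDG)
    simpa [ContinuousLinearMap.comp_apply, ContinuousLinearMap.flip_apply] using h
  -- (2) the frozen equation: `D(uncurry B)(t,x)[(1,u)] = Du(t)(x)[B]`
  have hBslice_t : HasDerivAt (fun s => B s x) (fderiv ℝ (Function.uncurry B) (t, x) (1, 0)) t := by
    have h1 : HasDerivAt (fun s : ℝ => (s, x)) (1, 0) t := (hasDerivAt_id t).prodMk (hasDerivAt_const t x)
    exact hBd.hasFDerivAt.comp_hasDerivAt t h1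
  have hBslice_x : HasFDerivAt (B t) ((fderiv ℝ (Function.uncurry B) (t, x)).comp (ContinuousLinearMap.inr ℝ ℝ E3)) x := by
    have h1 : HasFDerivAt (fun w : E3 => (t, w)) (ContinuousLinearMap.inr ℝ ℝ E3) x :=
      (hasFDerivAt_const t x).prodMk (hasFDerivAt_id x)
    exact hBd.hasFDerivAt.comp x h1
  have hfr : fderiv ℝ (Function.uncurry B) (t, x) ((1 : ℝ), u t x) = fderiv ℝ (u t) x (B t x) := by
    have h := hfrozen t ht x hx
    rw [hBslice_t.deriv, hBslice_x.fderiv] at h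
    have hsplit : ((1 : ℝ), u t x) = ((1 : ℝ), (0 : E3)) + ((0 : ℝ), u t x) := by simp
    rw [hsplit, map_add]
    have : (fderiv ℝ (Function.uncurry B) (t, x)) ((0 : ℝ), u t x)
        = ((fderiv ℝ (Function.uncurry B) (t, x)).comp (ContinuousLinearMap.inr ℝ ℝ E3)) (u t x) := rfl
    rw [this]
    rw [sub_eq_zero] at h
    linear_combination (norm := skip) h
    abel
  -- (3) the successor's x-derivative in the direction `B`
  have hsucc_ev : (fun z => deriv (fun s => θ s z) t + inner ℝ (u t z) (gradient (θ t) z))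
      =ᶠ[𝓝 x] fun z => fderiv ℝ F (t, z) ((1 : ℝ), u t z) := by
    filter_upwards [hU.mem_nhds hx] with z hz using succ_eq_fderiv hθ hI hU ht hz
  have huslice : HasFDerivAt (u t) ((fderiv ℝ (Function.uncurry u) (t, x)).comp (ContinuousLinearMap.inr ℝ ℝ E3)) x := by
    have h1 : HasFDerivAt (fun w : E3 => (t, w)) (ContinuousLinearMap.inr ℝ ℝ E3) x :=
      (hasFDerivAt_const t x).prodMk (hasFDerivAt_id x)
    exact hud.hasFDerivAt.comp x h1
  have hc : HasFDerivAt (fun z : E3 => fderiv ℝ F (t, z)) ((fderiv ℝ (fderiv ℝ F) (t, x)).comp (ContinuousLinearMap.inr ℝ ℝ E3)) x := by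
    have h1 : HasFDerivAt (fun w : E3 => (t, w)) (ContinuousLinearMap.inr ℝ ℝ E3) x :=
      (hasFDerivAt_const t x).prodMk (hasFDerivAt_id x)
    exact hDFd.hasFDerivAt.comp x h1
  have hw2 : HasFDerivAt (fun z : E3 => ((1 : ℝ), u t z))
      ((0 : E3 →L[ℝ] ℝ).prod ((fderiv ℝ (Function.uncurry u) (t, x)).comp (ContinuousLinearMap.inr ℝ ℝ E3))) x :=
    (hasFDerivAt_const (1 : ℝ) x).prodMk huslice
  have hH := hc.clm_apply hw2
  have key2 : inner ℝ (B t x) (gradient (fun z => deriv (fun s => θ s z) t + inner ℝ (u t z) (gradient (θ t) z)) x)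
      = (fderiv ℝ F (t, x)) (((0 : E3 →L[ℝ] ℝ).prod ((fderiv ℝ (Function.uncurry u) (t, x)).comp
            (ContinuousLinearMap.inr ℝ ℝ E3))) (B t x))
        + (fderiv ℝ (fderiv ℝ F) (t, x) ((0 : ℝ), B t x)) ((1 : ℝ), u t x) := by
    rw [real_inner_comm, _root_.inner_gradient_left, hsucc_ev.fderiv_eq, hH.fderiv]
    simp [ContinuousLinearMap.comp_apply, ContinuousLinearMap.flip_apply]
  -- (4) symmetry of the second derivative of `F`
  have hsymm : (fderiv ℝ (fderiv ℝ F) (t, x) ((0 : ℝ), B t x)) ((1 : ℝ), u t x)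
      = (fderiv ℝ (fderiv ℝ F) (t, x) ((1 : ℝ), u t x)) ((0 : ℝ), B t x) :=
    (hFat.isSymmSndFDerivAt (by
      rw [minSmoothness_of_isRCLikeNormedField]; exact WithTop.coe_le_coe.mpr le_top)) _ _
  -- (5) compare: the first-order terms agree by the frozen equation
  have hfirst : (fderiv ℝ F (t, x)) (((0 : E3 →L[ℝ] ℝ).prod ((fderiv ℝ (Function.uncurry u) (t, x)).comp
        (ContinuousLinearMap.inr ℝ ℝ E3))) (B t x))
      = (fderiv ℝ F (t, x)) (((0 : ℝ × E3 →L[ℝ] ℝ).prod (fderiv ℝ (Function.uncurry B) (t, x))) (1, u t x)) := by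
    congr 1
    ext
    · simp
    · simp only [ContinuousLinearMap.prod_apply, ContinuousLinearMap.comp_apply, ContinuousLinearMap.inr_apply]
      rw [hfr, huslice.fderiv]; rfl
  rw [key2, hsymm, hfirst]
  exact key1

end Step

/-! ### The radial-jerk tower: smoothness and the vortex-line integrals -/

section Tower

variable {u B : ℝ → E3 → E3} {x₀ : E3} {I : Set ℝ} {U : Set E3}

/-- Unfolding the successor of the tower. -/
theorem radialJerk_succ (u : ℝ → E3 → E3) (x₀ : E3) (k : ℕ) :
    radialJerk u x₀ (k + 1) = fun t x =>
      deriv (fun s => radialJerk u x₀ k s x) t + inner ℝ (u t x) (gradient (radialJerk u x₀ k t) x) := rfl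

/-- **Every radial jerk is jointly smooth on `I × U`** (induction on the level; crit-1 V21: «first formal step»). -/
theorem contDiffOn_radialJerk (hu : ContDiffOn ℝ (⊤ : ℕ∞) (Function.uncurry u) (I ×ˢ U)) (hI : IsOpen I)
    (hU : IsOpen U) (x₀ : E3) :
    ∀ k : ℕ, ContDiffOn ℝ (⊤ : ℕ∞) (Function.uncurry (radialJerk u x₀ k)) (I ×ˢ U)
  | 0 => by
      have h : (Function.uncurry (radialJerk u x₀ 0)) = fun p : ℝ × E3 => ‖p.2 - x₀‖ ^ 2 / 2 := by
        funext p; rfl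
      rw [h]
      exact (((contDiff_snd.sub contDiff_const).norm_sq ℝ).div_const _).contDiffOn
  | k + 1 => by
      rw [radialJerk_succ]
      exact contDiffOn_succ hu (contDiffOn_radialJerk hu hI hU x₀ k) hI hU

/-- **Every radial jerk is a vortex-line integral of a frozen sphere-tangent field**: `⟪B, ∇θ_k⟫ ≡ 0` on `I × U` for
all `k` (level `0` is the tangency `⟪B, x − x₀⟫ = 0`; the step is `ertel_step_frozen`). -/
theorem inner_gradient_radialJerk_eq_zero (hI : IsOpen I) (hU : IsOpen U)
    (hu : ContDiffOn ℝ (⊤ : ℕ∞) (Function.uncurry u) (I ×ˢ U))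
    (hB : ContDiffOn ℝ (⊤ : ℕ∞) (Function.uncurry B) (I ×ˢ U))
    (hfrozen : ∀ t ∈ I, ∀ x ∈ U,
      deriv (fun s => B s x) t + fderiv ℝ (B t) x (u t x) - fderiv ℝ (u t) x (B t x) = 0)
    (htan : ∀ t ∈ I, ∀ x ∈ U, inner ℝ (B t x) (x - x₀) = 0) :
    ∀ k : ℕ, ∀ t ∈ I, ∀ x ∈ U, inner ℝ (B t x) (gradient (radialJerk u x₀ k t) x) = 0
  | 0 => by
      intro t ht x hx
      have h : radialJerk u x₀ 0 t = fun y : E3 => ‖y - x₀‖ ^ 2 / 2 := rfl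
      rw [h, gradient_radial]
      exact htan t ht x hx
  | k + 1 => by
      intro t ht x hx
      have h := ertel_step_frozen hI hU hu hB (contDiffOn_radialJerk hu hI hU x₀ k) hfrozen
        (inner_gradient_radialJerk_eq_zero hI hU hu hB hfrozen htan k) t ht x hx
      rw [radialJerk_succ]
      exact h

end Tower

/-! ### Linear algebra: orthogonal to a frame ⇒ zero -/

/-- A vector orthogonal to `p`, `q`, `r` with `⟪p, q × r⟫ ≠ 0` vanishes (Cramer). -/
theorem eq_zero_of_inner_frame {w p q r : E3} (hp : inner ℝ w p = 0) (hq : inner ℝ w q = 0) (hr : inner ℝ w r = 0)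
    (hdet : inner ℝ p (cross q r) ≠ 0) : w = 0 := by
  simp only [cross, EuclideanSpace.inner_eq_star_dotProduct, dotProduct, Fin.sum_univ_three, crossProduct,
    LinearMap.mk₂_apply, Matrix.cons_val_zero, Matrix.cons_val_one, Matrix.cons_val_two,
    Matrix.head_cons, Matrix.tail_cons, star_trivial] at hp hq hr hdet
  set D := inner ℝ p (cross q r) with hD
  have h0 : w 0 * (p 0 * (q 1 * r 2 - q 2 * r 1) + p 1 * (q 2 * r 0 - q 0 * r 2) + p 2 * (q 0 * r 1 - q 1 * r 0)) = 0 := by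
    linear_combination (q 1 * r 2 - q 2 * r 1) * hp + (r 1 * p 2 - r 2 * p 1) * hq + (p 1 * q 2 - p 2 * q 1) * hr
  have h1 : w 1 * (p 0 * (q 1 * r 2 - q 2 * r 1) + p 1 * (q 2 * r 0 - q 0 * r 2) + p 2 * (q 0 * r 1 - q 1 * r 0)) = 0 := by
    linear_combination (q 2 * r 0 - q 0 * r 2) * hp + (r 2 * p 0 - r 0 * p 2) * hq + (p 2 * q 0 - p 0 * q 2) * hr
  have h2 : w 2 * (p 0 * (q 1 * r 2 - q 2 * r 1) + p 1 * (q 2 * r 0 - q 0 * r 2) + p 2 * (q 0 * r 1 - q 1 * r 0)) = 0 := by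
    linear_combination (q 0 * r 1 - q 1 * r 0) * hp + (r 0 * p 1 - r 1 * p 0) * hq + (p 0 * q 1 - p 1 * q 0) * hr
  have hdet' : p 0 * (q 1 * r 2 - q 2 * r 1) + p 1 * (q 2 * r 0 - q 0 * r 2) + p 2 * (q 0 * r 1 - q 1 * r 0) ≠ 0 := by
    intro h; apply hdet; linear_combination h
  ext i
  fin_cases i
  · simpa using (mul_eq_zero.mp h0).resolve_right hdet'
  · simpa using (mul_eq_zero.mp h1).resolve_right hdet'
  · simpa using (mul_eq_zero.mp h2).resolve_right hdet'

/-! ### The theorem -/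

/-- **INVISCID KINEMATIC RIGIDITY** (`ErtelTowerSketch.lean` Prop `InviscidKinematicRigidity`, general drift, closed BY NAME
over the twin): a field `B` FROZEN into a smooth drift `u` (`∂ₜB + DB[u] − Du[B] = 0`) and tangent to the spheres about `x₀`
on an open `I × U` vanishes identically as soon as, at each time, the set where the first three radial-jerk gradients
`x − x₀, ∇θ₁, ∇θ₂` span is dense in `U`.  Proof: levels 0, 1, 2 of the tower are vortex-line integrals
(`inner_gradient_radialJerk_eq_zero`, i.e. two general Ertel steps), Cramer (`eq_zero_of_inner_frame`) where the frame
spans, continuity of `B(t,·)` on `U` elsewhere.  Neither incompressibility of `u` nor `div B = 0` is used. -/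
theorem inviscidKinematicRigidity : InviscidKinematicRigidity := by
  intro u B x₀ I U hI hU hu hB hfrozen htan hdense t ht x hx
  have hlev := inner_gradient_radialJerk_eq_zero (x₀ := x₀) hI hU hu hB hfrozen htan
  -- off the degeneracy locus `B` vanishes
  set G : Set E3 := {z | z ∈ U ∧ inner ℝ (z - x₀)
      (cross (gradient (radialJerk u x₀ 1 t) z) (gradient (radialJerk u x₀ 2 t) z)) ≠ 0} with hG
  have hoff : ∀ z ∈ G, B t z = 0 := by
    rintro z ⟨hz, hdet⟩
    exact eq_zero_of_inner_frame (htan t ht z hz) (hlev 1 t ht z hz) (hlev 2 t ht z hz) hdet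
  -- density + continuity
  have hxcl : x ∈ closure G := hdense t ht hx
  have hcontU : ContinuousOn (B t) U := continuousOn_space hB hI hU ht
  have hGU : G ⊆ U := fun z hz => hz.1
  have hcont : ContinuousWithinAt (B t) G x := (hcontU.continuousWithinAt hx).mono hGU
  have hzero : (B t) =ᶠ[𝓝[G] x] fun _ => (0 : E3) := by
    filter_upwards [self_mem_nhdsWithin] with z hz using hoff z hz
  haveI : (𝓝[G] x).NeBot := mem_closure_iff_nhdsWithin_neBot.mp hxcl
  exact tendsto_nhds_unique hcont.tendsto (tendsto_const_nhds.congr' hzero.symm)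


end Summit.NavierStokesRegularity.NavierStokesRegularity.Theorems.PoloidalLiouville.ErtelTower
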